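import Summits.CriticalPhenomena.PercolationContinuityZ3.Theorems.PercRayRenewalJumpLineAvoidanceDecayEquivalences
import Summits.CriticalPhenomena.PercolationContinuityZ3.Theorems.PercRayRenewalJumpLineAvoidanceDecayAxialSecondMoment
import Summits.CriticalPhenomena.PercolationContinuityZ3.Theorems.PercRayRenewalJumpLineAvoidanceDecayBallSecondMoment
import Summits.CriticalPhenomena.PercolationContinuityZ3.Theorems.PercRayRenewalJumpLineAvoidanceDecayAxialTwoPoint
import Summits.CriticalPhenomena.PercolationContinuityZ3.Theorems.PercRayRenewalJumpLineAvoidanceDecayBallTwoPoint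
import Summits.CriticalPhenomena.PercolationContinuityZ3.Theses.PercTwoPointDecay
import HarnessLib

/-!
# Crux `PercRayRenewal.JumpLineAvoidanceDecay` (stmt-CriticalPhenomena-4626) — the two-point (infrared) form

Helper file of the line `registered` (lead c8), landing `--supports stmt-CriticalPhenomena-4626`.
Write G = `JumpLineAvoidanceDecay` (in the jump world `θ(p_c(ℤ³)) > 0` the axis segment
`e₀, …, m e₀` avoids the infinite cluster with probability `≤ C m^{-κ}`), `τ(x) = P_{p_c}(0 ↔ x)`
for the two-point (connectivity) function and `θ = θ(p_c)`. By FKG and a.s. uniqueness,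
`τ(x) ≥ θ²` for every `x` (Grimmett 1999 §8.5; `Grimmett1999_theta_sq_le_openConn_holds`), and
`τ(x) − θ²` is the CONNECTED two-point function. This file composes the six structural pieces
landed today (p167248 second-moment void bound, p167559 pointwise bound by the truncated one-arm
probability, p168412, p168650, p168761, p168855) with the landed equivalences of the line
(p148031: G → G1′, VD → G) into:

* `jumpLineAvoidanceDecay_iff_axialTwoPointDecay` :
  **G ⇔ (θ(p_c) > 0 → ∃ a > 0, C, ∀ n ≥ 1, τ(n e₀) − θ² ≤ C n^{-a})** — the crux is EXACTLY axial
  power decay of the connected two-point function at `p_c` in the jump world;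
* `jumpLineAvoidanceDecay_iff_ballTwoPointPowerSaving` :
  **G ⇔ (θ(p_c) > 0 → ∃ a > 0, C, ∀ R ≥ 1, Σ_{x ∈ Λ_R} (τ(x) − θ²) ≤ C R^{3−a})** — the crux is
  EXACTLY a power saving in the ball sum of the connected two-point function, i.e. the target
  `CritBallAverageDecay` of the sibling route `PercTwoPointDecay` written for `τ − θ²` instead of `τ`,
  read in the jump world: the percolation shadow of the infrared bound that drives the
  Aizenman–Duminil-Copin–Sidoravicius proof of continuity for the 3-d Ising model;
* `jumpLineAvoidanceDecay_of_critBallAverageDecay` : the cross-route edge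
  `PercTwoPointDecay.CritBallAverageDecay → G` (a power saving for `τ` is a fortiori one for
  `τ − θ²`; no vacuity is used, although `CritBallAverageDecay` does imply `θ(p_c) = 0` through that
  route's assembly).

No new mathematics: the content is in the six helper files; this file is bookkeeping.

## References

* G. Grimmett, *Percolation*, 2nd ed., Springer 1999, §8.5 p. 213 (`τ ≥ θ²`, uniqueness + FKG).
* M. Aizenman, H. Duminil-Copin, V. Sidoravicius, *Random currents and continuity of Ising model's
  spontaneous magnetization*, Comm. Math. Phys. 334 (2015) — the infrared-bound mechanism this form
  of G would imitate.
-/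

noncomputable section

namespace Summit.CriticalPhenomena.PercolationContinuityZ3.Theorems

open MeasureTheory Literature.Probability.Percolation Literature.Probability.LatticeModels

/-- **G ⇔ axial power decay of the connected two-point function (jump world).**
`JumpLineAvoidanceDecay` holds iff: `θ(p_c) > 0` implies that for some `a > 0` and `C`,
`P_{p_c}(0 ↔ n e₀) − θ(p_c)² ≤ C n^{-a}` for all `n ≥ 1`. (→: G → G1′ by
`jumpTruncatedOneArmDecay_of_jumpLineAvoidanceDecay`, then `axialTwoPointDecay_of_truncArmDecay`;
←: the axial second moment `lineAvoidanceDecay_of_axialTwoPointDecay`.) [folklore] -/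
theorem jumpLineAvoidanceDecay_iff_axialTwoPointDecay :
    Summit.CriticalPhenomena.PercolationContinuityZ3.Theses.PercRayRenewal.JumpLineAvoidanceDecay ↔
      (0 < theta (zdGraph 3) (0 : Site 3) (criticalProbI 3) →
        ∃ a C : ℝ, 0 < a ∧ ∀ n : ℕ, 1 ≤ n →
          (bondPercolation (zdGraph 3) (criticalProbI 3)).real
              (openConn (0 : Site 3) (Pi.single 0 (n : ℤ))) -
            theta (zdGraph 3) (0 : Site 3) (criticalProbI 3) ^ 2 ≤ C * (n : ℝ) ^ (-a)) := by
  constructor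
  · intro hG hθ
    have hG1 := jumpTruncatedOneArmDecay_of_jumpLineAvoidanceDecay hG
    unfold Summit.CriticalPhenomena.PercolationContinuityZ3.Theses.PercRayRenewal.JumpTruncatedOneArmDecay
      at hG1
    exact axialTwoPointDecay_of_truncArmDecay (criticalProbI 3) (hG1 hθ)
  · intro h
    unfold Summit.CriticalPhenomena.PercolationContinuityZ3.Theses.PercRayRenewal.JumpLineAvoidanceDecay
    intro hθ
    exact lineAvoidanceDecay_of_axialTwoPointDecay (criticalProbI 3) hθ (h hθ)

/-- **G ⇔ a power saving in the ball sum of the connected two-point function (jump world)** —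
the infrared form. `JumpLineAvoidanceDecay` holds iff: `θ(p_c) > 0` implies that for some `a > 0`
and `C`, `Σ_{x ∈ Λ_R} (P_{p_c}(0 ↔ x) − θ(p_c)²) ≤ C R^{3−a}` for all `R ≥ 1`. (→: G → G1′, then
`ballTwoPointPowerSaving_of_truncArmDecay`; ←: the ball second moment
`boxVoidDecay_of_ballTwoPointPowerSaving` gives the 3-d void decay VD, and VD → G is the landed
`jumpLineAvoidanceDecay_of_jumpBoxVoidDecay`.) [folklore] -/
theorem jumpLineAvoidanceDecay_iff_ballTwoPointPowerSaving :
    Summit.CriticalPhenomena.PercolationContinuityZ3.Theses.PercRayRenewal.JumpLineAvoidanceDecay ↔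
      (0 < theta (zdGraph 3) (0 : Site 3) (criticalProbI 3) →
        ∃ a C : ℝ, 0 < a ∧ ∀ R : ℕ, 1 ≤ R →
          ∑ x ∈ box 3 R, ((bondPercolation (zdGraph 3) (criticalProbI 3)).real (openConn (0 : Site 3) x) -
            theta (zdGraph 3) (0 : Site 3) (criticalProbI 3) ^ 2) ≤ C * (R : ℝ) ^ (3 - a)) := by
  constructor
  · intro hG hθ
    have hG1 := jumpTruncatedOneArmDecay_of_jumpLineAvoidanceDecay hG
    unfold Summit.CriticalPhenomena.PercolationContinuityZ3.Theses.PercRayRenewal.JumpTruncatedOneArmDecay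
      at hG1
    exact ballTwoPointPowerSaving_of_truncArmDecay (criticalProbI 3) (hG1 hθ)
  · intro h
    exact jumpLineAvoidanceDecay_of_jumpBoxVoidDecay fun hθ =>
      boxVoidDecay_of_ballTwoPointPowerSaving (criticalProbI 3) hθ (h hθ)

/-- **Cross-route edge: `PercTwoPointDecay.CritBallAverageDecay → JumpLineAvoidanceDecay`.**
A power saving `Σ_{x ∈ Λ_R} P_{p_c}(0 ↔ x) ≤ C R^{3−a}` for the two-point function itself is a
fortiori one for the connected two-point function (`θ(p_c)² ≥ 0` is subtracted termwise), hence
gives G by `jumpLineAvoidanceDecay_iff_ballTwoPointPowerSaving`. [folklore] -/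
theorem jumpLineAvoidanceDecay_of_critBallAverageDecay
    (hX : Summit.CriticalPhenomena.PercolationContinuityZ3.Theses.PercTwoPointDecay.CritBallAverageDecay) :
    Summit.CriticalPhenomena.PercolationContinuityZ3.Theses.PercRayRenewal.JumpLineAvoidanceDecay := by
  refine jumpLineAvoidanceDecay_iff_ballTwoPointPowerSaving.2 fun _ => ?_
  obtain ⟨a, C, ha, hC⟩ := hX
  refine ⟨a, C, ha, fun R hR => le_trans ?_ (hC R hR)⟩
  refine Finset.sum_le_sum fun x _ => ?_
  linarith [sq_nonneg (theta (zdGraph 3) (0 : Site 3) (criticalProbI 3))]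

end Summit.CriticalPhenomena.PercolationContinuityZ3.Theorems

end
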